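import Summits.QuantumAdvantage.QuantumAdvantage.Theses.CubicForrelation
import Summits.QuantumAdvantage.QuantumAdvantage.Theorems.NearExactIsExact.Negative.FifteenSixteenths
import Summits.QuantumAdvantage.QuantumAdvantage.Theorems.NearExactIsExact.Negative.MmPairFixedPoints
import Summits.QuantumAdvantage.QuantumAdvantage.Theorems.NearExactIsExact.Negative.SmallCasesClasses

/-!
# `NearExactIsExact` (stmt-QuantumAdvantage-14043), negative side — BQQ(8) is false: a bijective two-sided
Maiorana–McFarland cubic pair with `Φ = 15/16` already at `n = 16`

Disprover seat `b2b-cforr-disprove-g34` (2026-08-23).  HONEST FRAMING: an explicit decidable identity on `𝔽₂⁸` and its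
forrelation corollary — negative knowledge about the value landscape of cubic pairs, NOT a violation of the crux and not summit
progress (`15/16` is the standing lower bound for every admissible `θ`, `Negative/FifteenSixteenths.lean`).

`Negative/BqqSeven.lean` proves that for quadratic permutations `π, τ` of `𝔽₂⁷` with `τ ∘ π = id` the word `c₁ ⊕ c₂∘π`
(`c₁, c₂` cubic) is `0` or has weight `≥ 8 = 2^{m-4}` ("BQQ(7)"), so bijective Maiorana–McFarland pairs on `14` bits have
`Φ = 1` or `Φ ≤ 7/8`.  The seat's CONJECTURE BQQ (DISPROOF.md §9.3, quoted in `Negative/MmPairFixedPoints.lean`) asserted the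
same minimum distance `2^{m-4}` for every `m`; `Negative/PentagonFifteenSixteenths.lean` refuted it at `m = 10`.  Here we
show it fails at the FIRST possible size `m = 8`: for the triangular biquadratic permutation

  `π₈(x) = (x₀, x₁, x₂, x₃, x₄ ⊕ x₀x₂ ⊕ x₁x₂ ⊕ x₀x₃ ⊕ x₂x₃, x₅ ⊕ x₀x₁ ⊕ x₁x₃ ⊕ x₂x₃, x₆ ⊕ x₀x₁ ⊕ x₀x₂ ⊕ x₀x₃ ⊕ x₂x₃,
          x₇ ⊕ (x₀ ⊕ x₃)x₄ ⊕ (x₁ ⊕ x₃)x₅ ⊕ (x₂ ⊕ x₃)x₆)`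

(levels `(4, 3, 1)`: identity on `x₀..x₃`, three quadratic forms of the base added to `x₄, x₅, x₆`, and one "tower" coordinate
whose quadratic `u = (x₀⊕x₃)x₄ ⊕ (x₁⊕x₃)x₅ ⊕ (x₂⊕x₃)x₆` keeps the inverse `σ₈` quadratic, `sg8_pi8`) there are cubics
`cA` (on `x`) and `cB` (on `y`) with

  `cA(x) ⊕ cB(π₈ x) = 1_{x₀ = x₁ = x₂ = x₃ = x₄ = 0}`                      (`tower8_identity`, `decide`, 256 cases),

the indicator of a codimension-5 flat (weight `8 = 2^{m-5}`).  Hence the Maiorana–McFarland pair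
`g16b(y′‖y″) = y′·π₈(y″) ⊕ cA(y″)`, `f16b(x′‖x″) = x″·σ₈(x′) ⊕ cB(x′)` (both cubic) has, by the tree's fixed-point formula
`MmPairFixedPoints.forrelation_mmPair_of_leftInverse`, `Φ = (256 − 2·8)/256 = 15/16` (`forrelation_f16b_g16b`; the bare existential `∃ f g` cubic on `16` bits with `Φ = 15/16` is
already `Negative.exists_cubic_pair_forrelation_eq`, whose witness is NOT bijective — `σ` there has degree `4`): together with
`BqqSeven` the threshold for the value `15/16` inside the bijective Maiorana–McFarland class is exactly `m = 8` (`n = 16`).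

Provenance (seat folder `code/disprove-g34/allh2.py`, validation run on the one-level base of a two-level `(4,3,3)` configuration;
`b2b-cforr-disprove-g34/tower8_cert_swapped.json`): the exact all-height tower solver of DISPROOF §43.8 (E) lists every
height-1 tower over the 7-bit base carrying a codimension-5 configuration; this is one of them.  Everything below is a theorem;
`decide` is used only on `Fin 8 → Bool` (256 points); axioms are the standard three.
-/

set_option linter.dupNamespace false -- D-0017: single-problem summit ⇒ `QuantumAdvantage.QuantumAdvantage` by design

noncomputable section

namespace Summit.QuantumAdvantage.QuantumAdvantage.Theorems.NearExactIsExact.Negative.BqqEightFifteenSixteenths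

open Finset
open Literature.Computability.QuantumComplexity
open Summit.QuantumAdvantage.QuantumAdvantage.Theorems.NearExactIsExact.Negative
  (IsDegLeFun.bxor' IsDegLeFun.band' IsDegLeFun.bnot' isDegLeFun_coord isDegLeFun_coord₂)
open Summit.QuantumAdvantage.QuantumAdvantage.Theorems.NearExactIsExact.Negative.MmPairFixedPoints
  (forrelation_mmPair_of_leftInverse)
open Summit.QuantumAdvantage.QuantumAdvantage.Theorems.NearExactIsExact.Negative.SmallCases (bdot twist_eq_signOf_bdot)

/-- Points of `𝔽₂⁸`. -/
abbrev X := Fin 8 → Bool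

/-- The triangular biquadratic permutation `π₈` (levels `(4,3,1)`). -/
def pi8 (x : X) : X :=
  ![x 0, x 1, x 2, x 3,
    x 4 ^^ ((x 0 && x 2) ^^ (x 1 && x 2) ^^ (x 0 && x 3) ^^ (x 2 && x 3)), x 5 ^^ ((x 0 && x 1) ^^ (x 1 && x 3) ^^ (x 2 && x 3)), x 6 ^^ ((x 0 && x 1) ^^ (x 0 && x 2) ^^ (x 0 && x 3) ^^ (x 2 && x 3)), x 7 ^^ ((x 0 && x 4) ^^ (x 3 && x 4) ^^ (x 1 && x 5) ^^ (x 3 && x 5) ^^ (x 2 && x 6) ^^ (x 3 && x 6))]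

/-- Its inverse `σ₈` (also quadratic). -/
def sg8 (y : X) : X :=
  ![y 0, y 1, y 2, y 3,
    y 4 ^^ ((y 0 && y 2) ^^ (y 1 && y 2) ^^ (y 0 && y 3) ^^ (y 2 && y 3)), y 5 ^^ ((y 0 && y 1) ^^ (y 1 && y 3) ^^ (y 2 && y 3)), y 6 ^^ ((y 0 && y 1) ^^ (y 0 && y 2) ^^ (y 0 && y 3) ^^ (y 2 && y 3)), y 7 ^^ ((y 0 && y 1) ^^ (y 0 && y 3) ^^ (y 0 && y 4) ^^ (y 3 && y 4) ^^ (y 1 && y 5) ^^ (y 3 && y 5) ^^ (y 2 && y 6) ^^ (y 3 && y 6))]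

/-- The cubic `cA` on the `x` side (`42` monomials; it is `cB ∘ π₈ ⊕ 1_U`, forced by `cB`). -/
def cA (x : X) : Bool :=
  true ^^ x 0 ^^ x 1 ^^ x 2 ^^ x 3 ^^ x 4 ^^ (x 1 && x 2) ^^ (x 1 && x 3) ^^ (x 0 && x 4) ^^ (x 1 && x 4) ^^
  (x 2 && x 4) ^^ (x 1 && x 5) ^^ (x 0 && (x 1 && x 2)) ^^ (x 0 && (x 1 && x 3)) ^^ (x 0 && (x 2 && x 3)) ^^
  (x 0 && (x 1 && x 4)) ^^ (x 1 && (x 2 && x 4)) ^^ (x 0 && (x 3 && x 4)) ^^ (x 1 && (x 3 && x 4)) ^^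
  (x 2 && (x 3 && x 4)) ^^ (x 0 && (x 1 && x 5)) ^^ (x 0 && (x 2 && x 5)) ^^ (x 1 && (x 2 && x 5)) ^^
  (x 0 && (x 3 && x 5)) ^^ (x 1 && (x 3 && x 5)) ^^ (x 1 && (x 4 && x 5)) ^^ (x 2 && (x 4 && x 5)) ^^
  (x 3 && (x 4 && x 5)) ^^ (x 0 && (x 1 && x 6)) ^^ (x 0 && (x 2 && x 6)) ^^ (x 2 && (x 4 && x 6)) ^^
  (x 0 && (x 5 && x 6)) ^^ (x 1 && (x 5 && x 6)) ^^ (x 4 && (x 5 && x 6)) ^^ (x 0 && (x 1 && x 7)) ^^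
  (x 0 && (x 3 && x 7)) ^^ (x 1 && (x 3 && x 7)) ^^ (x 3 && (x 4 && x 7)) ^^ (x 0 && (x 5 && x 7)) ^^
  (x 1 && (x 5 && x 7)) ^^ (x 2 && (x 5 && x 7)) ^^ (x 1 && (x 6 && x 7))

/-- The cubic `cB` on the `y` side (`13` cubic monomials). -/
def cB (y : X) : Bool :=
  (y 0 && (y 4 && y 5)) ^^ (y 1 && (y 4 && y 5)) ^^ (y 2 && (y 4 && y 5)) ^^ (y 2 && (y 4 && y 6)) ^^
  (y 3 && (y 4 && y 6)) ^^ (y 0 && (y 5 && y 6)) ^^ (y 2 && (y 5 && y 6)) ^^ (y 4 && (y 5 && y 6)) ^^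
  (y 3 && (y 4 && y 7)) ^^ (y 0 && (y 5 && y 7)) ^^ (y 1 && (y 5 && y 7)) ^^ (y 2 && (y 5 && y 7)) ^^
  (y 1 && (y 6 && y 7))

/-- The indicator of the codimension-5 flat `U = {x₀ = x₁ = x₂ = x₃ = x₄ = 0}` (weight `8`). -/
def flat8 (x : X) : Bool := !x 0 && !x 1 && !x 2 && !x 3 && !x 4

set_option maxRecDepth 100000 in
/-- `σ₈ ∘ π₈ = id`: `π₈` is a quadratic permutation with quadratic inverse. [folklore] -/
theorem sg8_pi8 : ∀ x : X, sg8 (pi8 x) = x := by decide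

set_option maxRecDepth 100000 in
/-- `π₈ ∘ σ₈ = id`. [folklore] -/
theorem pi8_sg8 : ∀ y : X, pi8 (sg8 y) = y := by decide

set_option maxRecDepth 100000 in
/-- **The identity** `cA ⊕ cB ∘ π₈ = 1_U` with `U` a flat of codimension `5`: the code `RM(3,8) + RM(3,8)∘π₈` has a word of
weight `8 = 2^{m-5}` — CONJECTURE BQQ fails at `m = 8` (and `BqqSeven` shows it holds at `m = 7`). [folklore] -/
theorem tower8_identity : ∀ x : X, (cA x ^^ cB (pi8 x)) = flat8 x := by decide

/-! ### The Maiorana–McFarland pair on `8 + 8` bits -/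

/-- First half of a 16-bit vector. -/
def fst (x : Fin (8 + 8) → Bool) : X := fun i => x (Fin.castAdd 8 i)

/-- Second half of a 16-bit vector. -/
def snd (x : Fin (8 + 8) → Bool) : X := fun i => x (Fin.natAdd 8 i)

/-- The 8-term inner product `u · v` (right-nested xor, definitionally `SmallCases.bdot 8`). -/
def dot8 (u v : X) : Bool :=
  xor (u 0 && v 0) (xor (u 1 && v 1) (xor (u 2 && v 2) (xor (u 3 && v 3) (xor (u 4 && v 4)
    (xor (u 5 && v 5) (xor (u 6 && v 6) (xor (u 7 && v 7) false)))))))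

/-- `g16b(y′‖y″) = y′·π₈(y″) ⊕ cA(y″)` (Maiorana–McFarland, bent, cubic). -/
def g16b (y : Fin (8 + 8) → Bool) : Bool := xor (dot8 (fst y) (pi8 (snd y))) (cA (snd y))

/-- `f16b(x′‖x″) = x″·σ₈(x′) ⊕ cB(x′)` (Maiorana–McFarland over the INVERSE permutation: a bijective pair). -/
def f16b (x : Fin (8 + 8) → Bool) : Bool := xor (dot8 (snd x) (sg8 (fst x))) (cB (fst x))

/-- The first half of `a ++ b` is `a`. [folklore] -/
@[simp] theorem fst_append (a b : X) : fst (Fin.append a b) = a := by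
  funext i; exact Fin.append_left a b i

/-- The second half of `a ++ b` is `b`. [folklore] -/
@[simp] theorem snd_append (a b : X) : snd (Fin.append a b) = b := by
  funext i; exact Fin.append_right a b i

/-- `(-1)^{u·v}` is the twist. [folklore] -/
theorem signOf_dot8 (u v : X) : signOf (dot8 u v) = twist u v := by
  rw [twist_eq_signOf_bdot]
  rfl

set_option maxRecDepth 100000 in
/-- `cA` is cubic. [folklore] -/
theorem isDegLeFun_cA : IsDegLeFun 3 cA := by
  unfold cA
  repeat (first
      | exact isDegLeFun_coord _
      | exact isDegLeFun_coord₂ _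
      | exact isDegLeFun_apply _ (by norm_num)
      | exact isDegLeFun_const _ _
      | apply IsDegLeFun.bxor'
      | apply IsDegLeFun.band' (a := 1) (b := 1) (d := 2) _ _ (by norm_num)
      | apply IsDegLeFun.band' (a := 1) (b := 2) (d := 3) _ _ (by norm_num))

set_option maxRecDepth 100000 in
/-- `cB` is cubic. [folklore] -/
theorem isDegLeFun_cB : IsDegLeFun 3 cB := by
  unfold cB
  repeat (first
      | exact isDegLeFun_coord _
      | exact isDegLeFun_coord₂ _
      | exact isDegLeFun_apply _ (by norm_num)
      | apply IsDegLeFun.bxor'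
      | apply IsDegLeFun.band' (a := 1) (b := 1) (d := 2) _ _ (by norm_num)
      | apply IsDegLeFun.band' (a := 1) (b := 2) (d := 3) _ _ (by norm_num))

set_option maxRecDepth 100000 in
/-- `g16b` is cubic (structural bookkeeping). [folklore] -/
theorem isDegLeFun_g16b : IsDegLeFun 3 g16b := by
  unfold g16b dot8 fst snd pi8 cA
  simp only [Matrix.cons_val_zero, Matrix.cons_val_one, Matrix.cons_val]
  repeat (first
      | exact isDegLeFun_coord _
      | exact isDegLeFun_coord₂ _
      | exact isDegLeFun_apply _ (by norm_num)
      | exact isDegLeFun_const _ _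
      | apply IsDegLeFun.bxor'
      | apply IsDegLeFun.band' (a := 1) (b := 1) (d := 2) _ _ (by norm_num)
      | apply IsDegLeFun.band' (a := 1) (b := 2) (d := 3) _ _ (by norm_num))

set_option maxRecDepth 100000 in
/-- `f16b` is cubic. [folklore] -/
theorem isDegLeFun_f16b : IsDegLeFun 3 f16b := by
  unfold f16b dot8 fst snd sg8 cB
  simp only [Matrix.cons_val_zero, Matrix.cons_val_one, Matrix.cons_val]
  repeat (first
      | exact isDegLeFun_coord _
      | exact isDegLeFun_coord₂ _
      | exact isDegLeFun_apply _ (by norm_num)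
      | exact isDegLeFun_const _ _
      | apply IsDegLeFun.bxor'
      | apply IsDegLeFun.band' (a := 1) (b := 1) (d := 2) _ _ (by norm_num)
      | apply IsDegLeFun.band' (a := 1) (b := 2) (d := 3) _ _ (by norm_num))

/-- Every coordinate of `π₈` is quadratic. [folklore] -/
theorem isDegLeFun_pi8 : ∀ j : Fin 8, IsDegLeFun 2 (fun x : X => pi8 x j) := by
  rw [Fin.forall_fin_succ, Fin.forall_fin_succ, Fin.forall_fin_succ, Fin.forall_fin_succ, Fin.forall_fin_succ,
    Fin.forall_fin_succ, Fin.forall_fin_succ, Fin.forall_fin_one]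
  unfold pi8
  simp only [Matrix.cons_val_zero, Matrix.cons_val_succ, Matrix.cons_val_fin_one]
  refine ⟨?_, ?_, ?_, ?_, ?_, ?_, ?_, ?_⟩ <;>
  · repeat (first
        | exact isDegLeFun_coord₂ _
        | exact isDegLeFun_coord _
        | apply IsDegLeFun.bxor'
        | apply IsDegLeFun.band' (a := 1) (b := 1) (d := 2) _ _ (by norm_num))

/-- Every coordinate of `σ₈` is quadratic. [folklore] -/
theorem isDegLeFun_sg8 : ∀ j : Fin 8, IsDegLeFun 2 (fun y : X => sg8 y j) := by
  rw [Fin.forall_fin_succ, Fin.forall_fin_succ, Fin.forall_fin_succ, Fin.forall_fin_succ, Fin.forall_fin_succ,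
    Fin.forall_fin_succ, Fin.forall_fin_succ, Fin.forall_fin_one]
  unfold sg8
  simp only [Matrix.cons_val_zero, Matrix.cons_val_succ, Matrix.cons_val_fin_one]
  refine ⟨?_, ?_, ?_, ?_, ?_, ?_, ?_, ?_⟩ <;>
  · repeat (first
        | exact isDegLeFun_coord₂ _
        | exact isDegLeFun_coord _
        | apply IsDegLeFun.bxor'
        | apply IsDegLeFun.band' (a := 1) (b := 1) (d := 2) _ _ (by norm_num))

/-! ### The value -/

/-- Sign form of `g16b`. [folklore] -/
theorem signOf_g16b (y₁ y₂ : X) : signOf (g16b (Fin.append y₁ y₂)) = twist y₁ (pi8 y₂) * signOf (cA y₂) := by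
  rw [g16b, fst_append, snd_append, signOf_xor, signOf_dot8]

/-- Sign form of `f16b`. [folklore] -/
theorem signOf_f16b (x₁ x₂ : X) : signOf (f16b (Fin.append x₁ x₂)) = twist x₂ (sg8 x₁) * signOf (cB x₁) := by
  rw [f16b, fst_append, snd_append, signOf_xor, signOf_dot8]

/-- The flat `U` has `8` of the `256` points. [folklore] -/
theorem sum_flat8 : ∑ x : X, (if flat8 x = true then (1 : ℝ) else 0) = 8 := by
  have e : ∀ z : Fin (5 + 3) → Bool, (if flat8 z = true then (1 : ℝ) else 0) =
      (if (fun i : Fin 5 => z (Fin.castAdd 3 i)) = ![false, false, false, false, false] then (1 : ℝ) else 0) := by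
    intro z
    refine if_congr ?_ rfl rfl
    rw [funext_iff, Fin.forall_fin_succ, Fin.forall_fin_succ, Fin.forall_fin_succ, Fin.forall_fin_succ, Fin.forall_fin_one]
    simp only [flat8, Matrix.cons_val_zero, Matrix.cons_val_succ, Matrix.cons_val_fin_one, Bool.and_eq_true,
      Bool.not_eq_true']
    constructor
    · rintro ⟨⟨⟨⟨h0, h1⟩, h2⟩, h3⟩, h4⟩; exact ⟨h0, h1, h2, h3, h4⟩
    · rintro ⟨h0, h1, h2, h3, h4⟩; exact ⟨⟨⟨⟨h0, h1⟩, h2⟩, h3⟩, h4⟩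
  rw [show (∑ x : X, if flat8 x = true then (1 : ℝ) else 0) =
      ∑ z : Fin (5 + 3) → Bool, if flat8 z = true then (1 : ℝ) else 0 from rfl]
  rw [Finset.sum_congr rfl fun z _ => e z, sum_append]
  simp only [Fin.append_left]
  have e2 : ∀ a : Fin 5 → Bool, (∑ _b : Fin 3 → Bool, if (fun i => a i) = ![false, false, false, false, false] then (1 : ℝ) else 0)
      = if a = ![false, false, false, false, false] then (8 : ℝ) else 0 := by
    intro a
    rw [sum_const, card_univ, Fintype.card_fun, Fintype.card_bool, Fintype.card_fin, nsmul_eq_mul]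
    split_ifs <;> norm_num
  rw [Finset.sum_congr rfl fun a _ => e2 a, Finset.sum_ite_eq' univ, if_pos (mem_univ _)]

/-- `∑_y (-1)^{cA(y)} (-1)^{cB(π₈ y)} = 256 - 2·8 = 240`. [folklore] -/
theorem sum_sign_residual : ∑ y : X, signOf (cA y) * signOf (cB (pi8 y)) = 240 := by
  have e : ∀ y : X, signOf (cA y) * signOf (cB (pi8 y)) = 1 - 2 * (if flat8 y = true then (1 : ℝ) else 0) := by
    intro y
    rw [← signOf_xor, tower8_identity y]
    cases flat8 y <;> simp [signOf]; norm_num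
  rw [Finset.sum_congr rfl fun y _ => e y, sum_sub_distrib, ← mul_sum, sum_flat8, sum_const, card_univ,
    Fintype.card_fun, Fintype.card_bool, Fintype.card_fin]
  norm_num

/-- **`Φ(f16b, g16b) = 15/16`**: a bijective (`σ₈ ∘ π₈ = id`) two-sided Maiorana–McFarland cubic pair on `16` bits beyond
`7/8` — BQQ(8) is false, `BqqSeven` is sharp in `m`. [folklore] -/
theorem forrelation_f16b_g16b : forrelation f16b g16b = 15 / 16 := by
  rw [forrelation_mmPair_of_leftInverse f16b g16b pi8 sg8 cA cB signOf_g16b signOf_f16b sg8_pi8, sum_sign_residual]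
  norm_num

/-- The coding statement refuting BQQ(8): quadratic `π, τ` on `𝔽₂⁸` with `τ ∘ π = id` (both of degree `≤ 2`) and cubics
`c₁, c₂` whose word `c₁ ⊕ c₂∘π` is the indicator of a codimension-5 flat (weight `8 < 16 = 2^{m-4}`). [folklore] -/
theorem exists_bqq_eight_counterexample :
    ∃ (π τ : X → X) (c₁ c₂ : X → Bool), (∀ j, IsDegLeFun 2 (fun x => π x j)) ∧ (∀ j, IsDegLeFun 2 (fun y => τ y j)) ∧
      (∀ x, τ (π x) = x) ∧ IsDegLeFun 3 c₁ ∧ IsDegLeFun 3 c₂ ∧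
      (∀ x, (c₁ x ^^ c₂ (π x)) = (!x 0 && !x 1 && !x 2 && !x 3 && !x 4)) :=
  ⟨pi8, sg8, cA, cB, isDegLeFun_pi8, isDegLeFun_sg8, sg8_pi8, isDegLeFun_cA, isDegLeFun_cB, tower8_identity⟩

end Summit.QuantumAdvantage.QuantumAdvantage.Theorems.NearExactIsExact.Negative.BqqEightFifteenSixteenths
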